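import Summits.CriticalPhenomena.SAWScalingLimit.Theorems.SAWLoopFugacityFlowAvoidanceLimitExcursionRatioGreen
import Literature.Probability.LatticeModels.SRWKilledWalkFunctionals

/-!
# The matrix-inverse Green's function `greenEntry` IS the killed-SRW Green's function
# `SRW.killedGreen` (bridge "matrix inverse = expected number of visits")
— helper of stub `stub_greenConvergence` (GC) of line `symplectic-fermion-anchor`
(crux `SAWLoopFugacityFlow.AvoidanceLimit`, stmt-CriticalPhenomena-10649; lead c2 GC-sandwich
programme, brick W-A)

**What.** For a subgraph `K ≤ ℤ²` every edge of which has its endpoints in a finite volume `Λ`, and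
`u, v ∈ Λ`, the entry `((1 − ¼A_{K|Λ})⁻¹)_{uv}` — the anchor's `greenEntry K Λ u v`
(`SAWLoopFugacityFlowAvoidanceLimitAnchorDefs`) — equals the probabilistic Green's function
`SRW.killedGreen K u v = Σ_n P[the first n steps of SRW from u are K-edges, position n = v]`, the
expected number of visits to `v` of the simple random walk on `ℤ²` started at `u` and killed at its
first step that is not a `K`-edge (`Literature/Probability/LatticeModels/SRWKilledWalkFunctionals`).

**Why.** The stubs of the line speak about `greenEntry`; the tree's convergence theorem for discrete
Green's functions speaks about `SRW.killedGreen`. This file is the bridge (`greenEntry_eq_killedGreen`,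
registered signature).

**Proof.** `K.support ⊆ Λ` is finite, so the first-step equation
`SRW.killedGreen_first_step_of_finite_support` holds: `G(p,v) = [p = v] + ¼ Σ_e [p ∼_K p+e] G(p+e,v)`.
The `K`-neighbours of `p` are exactly the points `p + e` (`e` one of the four unit steps, unique)
with `K.Adj p (p + e)`, and they lie in `Λ`; so the direction sum is the sum over the `K`-neighbours
of `p` in `Λ`, i.e. `(P g)(p)` with `P = ¼A_{K|Λ}` and `g = G(·, v)|_Λ`. Hence `(1 − P) g = δ_v`;
as `1 − P` is invertible (`KilledGreen.isUnit_one_sub_transition`), `g = (1 − P)⁻¹ δ_v`, whose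
`u`-entry is `greenEntry K Λ u v` (cf. the tree's `KozdronLawler.killedGreen_siteGraph_eq_four_mul_
dirichletGreen`, the same bridge for site-killed walks).

Sources: G. F. Lawler, *Intersections of Random Walks* (1991), §1.5 (the Green's function of the
killed walk, `G = Σ_n Pⁿ = (I − P)⁻¹`) [Lawler1991]; folklore linear algebra. No definitions; nothing
from the literature is asserted here.
-/

noncomputable section

open scoped BigOperators Topology Classical
open Filter Finset Matrix
open Literature.Probability.RandomPlanarGeometry Literature.Probability.LatticeModels

namespace Summit.CriticalPhenomena.SAWScalingLimit.Theorems.AvoidanceLimit.Anchor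

open KilledGreen

/-! ## Finiteness of the support and the direction sum of the first-step equation -/

/-- If every `K`-edge starts in `Λ`, the non-isolated vertices of `K` lie in the finite set `Λ`;
in particular `K.support` is finite (so `SRW.killedGreen K` converges and satisfies the first-step
equation). [folklore] -/
theorem finite_support_of_adj_mem {K : SimpleGraph (Site 2)} {Λ : Finset (Site 2)}
    (hΛ : ∀ x y : Site 2, K.Adj x y → x ∈ Λ) : K.support.Finite :=
  Λ.finite_toSet.subset fun x hx => by
    obtain ⟨y, hy⟩ := (SimpleGraph.mem_support _).1 hx
    exact hΛ x y hy

/-- **The direction sum of the first-step equation is the sum over the `K`-neighbours in `Λ`**: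
for `K ≤ ℤ²` with every edge starting in `Λ`, the `K`-neighbours of `p` in `Λ` are exactly the
points `p + e` (`e` a unit step, unique by `SRW.stepVec_injective`) with `K.Adj p (p + e)`.
[folklore] -/
theorem sum_dir_ite_adj_eq_sum_filter {K : SimpleGraph (Site 2)} (hK : K ≤ zdGraph 2)
    {Λ : Finset (Site 2)} (hΛ : ∀ x y : Site 2, K.Adj x y → x ∈ Λ) (f : Site 2 → ℝ) (p : Site 2) :
    (∑ e : SRW.Dir 2, if K.Adj p (p + SRW.stepVec e) then f (p + SRW.stepVec e) else 0) =
      ∑ y ∈ univ.filter (fun y : Λ => K.Adj p y.1), f y := by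
  rw [← Finset.sum_filter]
  refine Finset.sum_bij
    (fun e he => ⟨p + SRW.stepVec e, hΛ _ _ (Finset.mem_filter.1 he).2.symm⟩) ?_ ?_ ?_ ?_
  · intro e he
    exact Finset.mem_filter.2 ⟨Finset.mem_univ _, (Finset.mem_filter.1 he).2⟩
  · intro e₁ _ e₂ _ h
    exact SRW.stepVec_injective (add_left_cancel (congrArg Subtype.val h))
  · intro y hy
    obtain ⟨e, he⟩ := SRW.exists_dir_of_adj (hK (Finset.mem_filter.1 hy).2)
    refine ⟨e, Finset.mem_filter.2 ⟨Finset.mem_univ _, ?_⟩, Subtype.ext he.symm⟩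
    rw [← he]
    exact (Finset.mem_filter.1 hy).2
  · intro e _
    rfl

/-! ## The killed Green's function solves `(1 − P) g = δ_v` -/

/-- **The killed Green's function solves the linear system defining `greenEntry`**: for `K ≤ ℤ²`
with every edge starting in `Λ`, the restriction to `Λ` of `p ↦ SRW.killedGreen K p v` satisfies
`(1 − ¼A_{K|Λ}) g = δ_v` (first-step equation / harmonicity of the killed Green's function off its
pole). [cite: Lawler1991, §1.5] -/
theorem one_sub_transition_mulVec_killedGreen {K : SimpleGraph (Site 2)} (hK : K ≤ zdGraph 2)
    {Λ : Finset (Site 2)} (hΛ : ∀ x y : Site 2, K.Adj x y → x ∈ Λ) (v : Site 2) :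
    ((1 : Matrix Λ Λ ℝ) - (4 : ℝ)⁻¹ • adjMat K Λ) *ᵥ (fun p : Λ => SRW.killedGreen K p v) =
      fun p : Λ => if (p : Site 2) = v then 1 else 0 := by
  funext p
  rw [Matrix.sub_mulVec, Matrix.one_mulVec, Pi.sub_apply, transition_mulVec_apply,
    ← sum_dir_ite_adj_eq_sum_filter hK hΛ (fun z => SRW.killedGreen K z v) p]
  have hfs := SRW.killedGreen_first_step_of_finite_support (finite_support_of_adj_mem hΛ)
    (p : Site 2) v
  have h4 : (2 * (2 : ℕ) : ℝ)⁻¹ = (4 : ℝ)⁻¹ := by norm_num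
  rw [h4] at hfs
  linarith

/-! ## The bridge -/

/-- **Matrix-inverse Green's function = expected number of visits** (registered stub
`greenEntry_eq_killedGreen`, brick W-A of the GC sandwich): for `K ≤ ℤ²` all of whose edges have
their endpoints in `Λ` and `u, v ∈ Λ`,
`greenEntry K Λ u v = ((1 − ¼A_{K|Λ})⁻¹)_{uv} = SRW.killedGreen K u v`
(`= Σ_n P^u[first n steps are K-edges, S_n = v]`, Lawler's `G(x,y) = Σ_j Pˣ{S_j = y, j < τ} =
((I − P)⁻¹)_{xy}`). [cite: Lawler1991, §1.5] -/
theorem greenEntry_eq_killedGreen :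
    ∀ (K : SimpleGraph (Site 2)) (Λ : Finset (Site 2)) (u v : Site 2), K ≤ zdGraph 2 →
      (∀ x y : Site 2, K.Adj x y → x ∈ Λ) → u ∈ Λ → v ∈ Λ →
      greenEntry K Λ u v = SRW.killedGreen K u v := by
  intro K Λ u v hK hΛ hu hv
  have hU : IsUnit ((1 : Matrix Λ Λ ℝ) - (4 : ℝ)⁻¹ • adjMat K Λ).det :=
    (Matrix.isUnit_iff_isUnit_det _).1 (isUnit_one_sub_transition Λ hK)
  -- `g = G(·, v)|_Λ` is `(1 − P)⁻¹ δ_v`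
  have hsolve : (fun p : Λ => SRW.killedGreen K p v) =
      ((1 : Matrix Λ Λ ℝ) - (4 : ℝ)⁻¹ • adjMat K Λ)⁻¹ *ᵥ
        fun p : Λ => if (p : Site 2) = v then 1 else 0 := by
    rw [← one_sub_transition_mulVec_killedGreen hK hΛ v, Matrix.mulVec_mulVec,
      Matrix.nonsing_inv_mul _ hU, Matrix.one_mulVec]
  -- its `u`-entry is the `(u, v)` entry of `(1 − P)⁻¹`
  have hgu : SRW.killedGreen K u v =
      ((1 : Matrix Λ Λ ℝ) - (4 : ℝ)⁻¹ • adjMat K Λ)⁻¹ ⟨u, hu⟩ ⟨v, hv⟩ := by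
    have h := congr_fun hsolve ⟨u, hu⟩
    simp only [Matrix.mulVec, dotProduct, mul_ite, mul_one, mul_zero] at h
    rw [h, Finset.sum_eq_single ⟨v, hv⟩]
    · rw [if_pos rfl]
    · intro z _ hz
      exact if_neg fun h' => hz (Subtype.ext h')
    · intro h'
      exact absurd (Finset.mem_univ _) h'
  rw [hgu, greenEntry, dif_pos ⟨hu, hv⟩]

end Summit.CriticalPhenomena.SAWScalingLimit.Theorems.AvoidanceLimit.Anchor

end
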